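import Mathlib
import Literature.Geometry.Lorentzian.FinalEraPackage
import HarnessLib

/-!
# Rest-frame Statement-shaped settling data of a final era (hypothesis predicate)

A companion of `Literature.Geometry.Lorentzian.FinalEraPackage` / `FinalEraPackage2` (the 29- and 31-clause
final-era packages of a Cauchy development, route `DissipativeFinalMotions` of the summit
`FinalStateConjecture`). The capture step of that route ("a dispersing final era settles to boosted
Kerr black holes") was found UNDER-HYPOTHESISED twice (crux `DispersingCapture`, leads c1/c2,
2026-08-17, `Summits/…/Cruxes/DispersingCapture/Lines/birth-dead*.md`): the package certifies `C²`
flatness of the flat chart only FAR from the holes ((F3)), exhaustion only for CONSTANT-radius zones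
`{rᵢ ≤ 2ρ₀}` ((EX)), and compares the hole clocks with the flat clock only qualitatively ((X4)), whereas
the Statement's `HasExhaustiveCharts` needs, in the holes' rest frames, a flat chart that is `C²`-flat on
WHOLE slabs of a domain containing the late half-space minus DRIFTING sublinear tubes, honest GROWING
near-zone radii with convergence out to them, and exhaustion of the exterior region by exactly these
growing zones. This file records that rest-frame settling data as ONE predicate over the package's own
binders `T, ξ, B₀, B, Ψ₀, Ψ, O` plus two new ones, `ρ : ℝ → ℝ` (tube profile) and `R : Fin N → ℝ → ℝ`
(radii), so that a restated route item can say `𝒟.IsFinalEra₂ … ∧ 𝒟.IsRestFrameSettled …` within the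
gate's signature-length cap. **No printed formulation exists** (hypothesis predicate; the late-time
`N`-body picture of the final state conjecture, Dafermos–Luk arXiv:1710.01722, p. 8 and Conjecture 1, in
the consequence-form vocabulary of `KerrConvergence`). Nothing is asserted.

## Contents

* `CauchyDevelopment.IsRestFrameSettled 𝒟 N M a T ξ B₀ B Ψ₀ Ψ O ρ R` — the conjunction of seven clauses:
  (S1) `ρ(t)/t → 0`; (S2) `B₀.domain ⊇ {t > T} ∖ ⋃ᵢ {‖y̲ − ξᵢ(t)‖ ≤ ρ(t)}`; (S3) `deviationCk B₀ Ψ₀ 2 τ → 0`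
  (full-slab `C²` flatness); (S4) `Rᵢ → ∞` and `Rᵢ(τ) ≥ max(r₊(Mᵢ,aᵢ),0) + 1` (honest radii); (S5)
  `truncDeviationCk (B i) (Ψ i) 2 (Rᵢ τ) τ → 0`; (S6) for every `τ₁ > T`, every point of `O` neither in
  `Ψ₀({t > τ₁})` nor in some `Ψᵢ({t*ᵢ > τ₁, rᵢ ≤ Rᵢ(t*ᵢ)})` lies in
  `J⁻(Ψ₀({t = τ₁}) ∪ ⋃ᵢ Ψᵢ({t*ᵢ = τ₁, rᵢ ≤ Rᵢ(τ₁)}))` (the `certifiedLate`/`certifiedSlab` shape of the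
  summit's `HasExhaustiveCharts`, with trivial motions); (S7) eventually in `τ`, at every point of the flat
  slab `{t = τ}` the push-forward `dΨ₀(∂₀)` is future-directed causal.
* `IsRestFrameSettled.tendsto_truncDeviationCk` — (S4)+(S5) give convergence at every FIXED radius.
* `IsRestFrameSettled.eventually_isFutureDirected_far` — (S7) gives the far-restricted orientation clause
  of the rev-3 route items for every distance `ϱ₀`.

## Design choices

Those of `FinalEraPackage`: carrier `CauchyDevelopment D`; clause types verbatim those a prover consumes
(`Spacetime.deviationCk/truncDeviationCk`, `ModelBackground.lateRegion/timeSlab/truncTimeSlab`,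
`LorentzianMetric.causalPast`, `TimeOrientation.IsFutureDirected`); the backgrounds are NOT pinned here
(the package's equations (B) do that). Deliberately not here: the package itself, velocities, boosts.

## References

* M. Dafermos, J. Luk, arXiv:1710.01722, p. 8 and Conjecture 1 (final state picture).
* M. Dafermos, G. Holzegel, I. Rodnianski, M. Taylor, arXiv:2104.08222, §1 (near zones, late charts; via
  `KerrConvergence`).
-/

noncomputable section

open Set TopologicalSpace Filter MeasureTheory
open scoped Manifold ContDiff Topology ENNReal

universe u

namespace Literature.Geometry.Lorentzian

variable {X : Type u} [TopologicalSpace X] [ChartedSpace E3 X] [IsManifold (𝓡 3) ∞ X]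
  [ConnectedSpace X] {D : InitialDataSet (𝓡 3) X}

/-- **The final era `(T, ξ, B₀, B, Ψ₀, Ψ, O)` of the Cauchy development `𝒟` settles in the rest frames,
with tube profile `ρ` and near-zone radii `R`** (hypothesis predicate; seven clauses): (S1) the tube
profile is sublinear, `ρ(t)/t → 0`; (S2) the flat domain contains the late half-space `{t > T}` minus
the drifting tubes `{‖y̲ − ξᵢ(t)‖ ≤ ρ(t)}`; (S3) `Ψ₀^* g → η` in `C²` on WHOLE flat slabs `{t = τ}`;
(S4) honest growing radii, `Rᵢ(τ) → ∞` and `Rᵢ(τ) ≥ max(r₊(Mᵢ, aᵢ), 0) + 1`; (S5) `Ψᵢ^* g → g₀` in `C²`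
on the growing truncated slabs `{t*ᵢ = τ, rᵢ ≤ Rᵢ(τ)}`; (S6) EXHAUSTION: for every chart time `τ₁ > T`,
every point of `O` neither in `Ψ₀({t > τ₁})` nor in some growing zone `Ψᵢ({t*ᵢ > τ₁, rᵢ ≤ Rᵢ(t*ᵢ)})`
lies in the causal past of the certified slab `Ψ₀({t = τ₁}) ∪ ⋃ᵢ Ψᵢ({t*ᵢ = τ₁, rᵢ ≤ Rᵢ(τ₁)})`; (S7)
eventually in `τ`, `dΨ₀(∂₀)` is future-directed causal at every point of the flat slab `{t = τ}`. This
is a HYPOTHESIS PREDICATE (a definition recording data a route item consumes; nothing is asserted and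
nothing is claimed to hold): the late-time `N`-body picture of Dafermos–Luk, arXiv:1710.01722, p. 8, in
the holes' rest frames, in the consequence-form vocabulary of `KerrConvergence` (no printed formulation,
exactly as for `FinalEraPackage`). [cite: DafermosLuk2017, p. 8] -/
def CauchyDevelopment.IsRestFrameSettled (𝒟 : CauchyDevelopment D) (N : ℕ) (M a : Fin N → ℝ) (T : ℝ)
    (ξ : Fin N → ℝ → E3) (B₀ : ModelBackground) (B : Fin N → ModelBackground)
    (Ψ₀ : B₀.domain → 𝒟.carrier) (Ψ : (i : Fin N) → (B i).domain → 𝒟.carrier) (O : Set 𝒟.carrier)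
    (ρ : ℝ → ℝ) (R : Fin N → ℝ → ℝ) : Prop :=
  Tendsto (fun t ↦ ρ t / t) atTop (𝓝 0) ∧
  {y : E4 | T < y 0 ∧ ∀ i, ρ (y 0) < ‖E4.spatial y - ξ i (y 0)‖} ⊆ (B₀.domain : Set E4) ∧
  Tendsto (fun τ ↦ 𝒟.toSpacetime.deviationCk B₀ Ψ₀ 2 τ) atTop (𝓝 0) ∧
  (∀ i, Tendsto (R i) atTop atTop ∧ ∀ τ, max (Kerr.rPlus (M i) (a i)) 0 + 1 ≤ R i τ) ∧
  (∀ i, Tendsto (fun τ ↦ 𝒟.toSpacetime.truncDeviationCk (B i) (Ψ i) 2 (R i τ) τ) atTop (𝓝 0)) ∧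
  (∀ τ₁, T < τ₁ → O \ (Ψ₀ '' B₀.lateRegion τ₁ ∪
      ⋃ i, Ψ i '' {x : (B i).domain | τ₁ < (B i).time x.1 ∧ (B i).radius x.1 ≤ R i ((B i).time x.1)}) ⊆
    𝒟.toSpacetime.metric.causalPast 𝒟.toSpacetime.timeOrientation
      (Ψ₀ '' B₀.timeSlab τ₁ ∪ ⋃ i, Ψ i '' (B i).truncTimeSlab (R i τ₁) τ₁)) ∧
  (∀ᶠ τ in atTop, ∀ x ∈ B₀.timeSlab τ, 𝒟.toSpacetime.timeOrientation.IsFutureDirected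
    (mfderiv 𝓘(ℝ, E4) (𝓡 4) Ψ₀ x (E4.basisVector 0)))

namespace CauchyDevelopment.IsRestFrameSettled

variable {𝒟 : CauchyDevelopment D} {N : ℕ} {M a : Fin N → ℝ} {T : ℝ} {ξ : Fin N → ℝ → E3}
  {B₀ : ModelBackground} {B : Fin N → ModelBackground} {Ψ₀ : B₀.domain → 𝒟.carrier}
  {Ψ : (i : Fin N) → (B i).domain → 𝒟.carrier} {O : Set 𝒟.carrier} {ρ : ℝ → ℝ} {R : Fin N → ℝ → ℝ}

/-- (S4) + (S5) give near-zone `C²` convergence at every FIXED radius `R'`: eventually `R' ≤ Rᵢ(τ)`, and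
the truncated deviation is monotone in the radius (DHRT arXiv:2104.08222, §1, the region `{r ≤ R}`).
[cite: arXiv210408222, §1] -/
theorem tendsto_truncDeviationCk (h : 𝒟.IsRestFrameSettled N M a T ξ B₀ B Ψ₀ Ψ O ρ R) (i : Fin N)
    (R' : ℝ) :
    Tendsto (fun τ ↦ 𝒟.toSpacetime.truncDeviationCk (B i) (Ψ i) 2 R' τ) atTop (𝓝 0) :=
  tendsto_of_tendsto_of_tendsto_of_le_of_le' tendsto_const_nhds (h.2.2.2.2.1 i)
    (Eventually.of_forall fun _ ↦ zero_le)
    (((h.2.2.2.1 i).1.eventually_ge_atTop R').mono fun τ hτ ↦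
      𝒟.toSpacetime.truncDeviationCk_mono (B i) (Ψ i) 2 hτ τ)

/-- (S7) implies the far-restricted orientation clause (F₀) of the rev-3 route items for every flat
distance `ϱ₀` (the distance guard is simply dropped). O'Neill 1983, Ch. 5, p. 145 (time orientation by a
timelike vector field); hypothesis bookkeeping. [cite: ONeill1983, Ch. 5  p. 145] -/
theorem eventually_isFutureDirected_far (h : 𝒟.IsRestFrameSettled N M a T ξ B₀ B Ψ₀ Ψ O ρ R)
    (ϱ₀ : ℝ) :
    ∀ᶠ τ in atTop, ∀ x ∈ B₀.timeSlab τ, (∀ i, ϱ₀ ≤ ‖E4.spatial x.1 - ξ i τ‖) →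
      𝒟.toSpacetime.timeOrientation.IsFutureDirected
        (mfderiv 𝓘(ℝ, E4) (𝓡 4) Ψ₀ x (E4.basisVector 0)) :=
  h.2.2.2.2.2.2.mono fun _ hτ x hx _ ↦ hτ x hx

end CauchyDevelopment.IsRestFrameSettled

/-! ### Settled charts on a THINNED flat domain (the form a route item can assume next to the package)

Appended 2026-08-17 (lead c3 of the crux `DispersingCapture`). `IsRestFrameSettled` above states the settling
clauses for the package's OWN flat chart `(B₀, Ψ₀)`. Next to the rev-2 package this is jointly unsatisfiable
as soon as `N ≥ 1`: clause (F2) of `FinalEraPackage₂` makes the flat domain contain every late point at flat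
distance `> ρ₀` (a CONSTANT) from the holes, (X3) charts a point at flat distance `ρ₀ + 1` by a hole chart at
bounded Kerr–Schild radius, where (S4)/(S5) make the geometry `C²`-close to Kerr — nowhere flat — while (S3)
would make it `C²`-close to Minkowski at the same point (curvature is chart-independent). The intended
settled flat chart is the RESTRICTION of `Ψ₀` to a thinned domain `U₁ = U₀ ∖ ⋃ᵢ {distᵢ ≤ ρ(t)}` with a
drifting profile `ρ(t) → ∞`, restarted at a later time `T₁`; the predicate below therefore takes the thinned
domain `U₁`, the flat chart `Φ₀` on it and the restart time `T₁` as binders of their own, and carries the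
three bookkeeping clauses that tie them to the region `O` (late charts into `O`; the region identity). It is
exactly the output of the "rest-frame settled data" step of the route's capture line
(`Summits/FinalStateConjecture/FinalStateConjecture/Cruxes/DispersingCapture/Lines/birth.lean`, stub B₁), so
that a restated item `IsFinalEra₂ … → IsRestFrameSettledOn … → …` is closed by the landed capture theorem
(`Theorems/DissipativeFinalMotionsDispersingCaptureStubCaptureOfSettled.lean`). -/

/-- **The final era settles in the rest frames on the thinned flat domain `U₁` with flat chart `Φ₀` after
`T₁`, tube profile `ρ` and radii `R`** (hypothesis predicate; ten clauses): (C0) `Φ₀` is a late-time chart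
into `O` after `T₁` on the Minkowski background over `U₁`; (C1) every hole chart `Ψᵢ` is a late-time chart
into `O` after `T₁`; (S1) `ρ(t)/t → 0`; (S2) `U₁ ⊇ {t > T₁} ∖ ⋃ᵢ {‖y̲ − ξᵢ(t)‖ ≤ ρ(t)}`; (S3) `Φ₀^* g → η`
in `C²` on WHOLE slabs `{t = τ} ∩ U₁`; (S4) honest radii `Rᵢ → ∞`, `Rᵢ(τ) ≥ max(r₊(Mᵢ,aᵢ),0) + 1`; (S5)
`Ψᵢ^* g → g₀` in `C²` on `{t*ᵢ = τ, rᵢ ≤ Rᵢ(τ)}`; (O1) the region identity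
`O = J⁺(ι X) ∩ I⁻(Φ₀({t > T₁}) ∪ ⋃ᵢ Ψᵢ({t*ᵢ > T₁}))` (the body of the summit's `exteriorOf`); (S6)
EXHAUSTION: for every `τ₁ > T₁`, every point of `O` neither in `Φ₀({t > τ₁})` nor in some growing zone
`Ψᵢ({t*ᵢ > τ₁, rᵢ ≤ Rᵢ(t*ᵢ)})` lies in `J⁻(Φ₀({t = τ₁}) ∪ ⋃ᵢ Ψᵢ({t*ᵢ = τ₁, rᵢ ≤ Rᵢ(τ₁)}))`; (S7)
eventually in `τ`, `dΦ₀(∂₀)` is future-directed causal on the whole flat slab `{t = τ} ∩ U₁`. A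
HYPOTHESIS PREDICATE (a definition recording data a route item consumes; nothing is asserted and
nothing is claimed to hold): the late-time `N`-body picture of Dafermos–Luk, arXiv:1710.01722, p. 8, in
the holes' rest frames and on the radiation zone outside sublinearly drifting tubes, in the
consequence-form vocabulary of `KerrConvergence` (no printed formulation, exactly as for
`FinalEraPackage`). [cite: DafermosLuk2017, p. 8] -/
def CauchyDevelopment.IsRestFrameSettledOn (𝒟 : CauchyDevelopment D) (N : ℕ) (M a : Fin N → ℝ)
    (T₁ : ℝ) (ξ : Fin N → ℝ → E3) (B : Fin N → ModelBackground)
    (Ψ : (i : Fin N) → (B i).domain → 𝒟.carrier) (O : Set 𝒟.carrier) (U₁ : Opens E4)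
    (Φ₀ : (Minkowski.backgroundOn U₁).domain → 𝒟.carrier) (ρ : ℝ → ℝ) (R : Fin N → ℝ → ℝ) : Prop :=
  𝒟.toSpacetime.IsLateChart (Minkowski.backgroundOn U₁) O T₁ Φ₀ ∧
  (∀ i, 𝒟.toSpacetime.IsLateChart (B i) O T₁ (Ψ i)) ∧
  Tendsto (fun t ↦ ρ t / t) atTop (𝓝 0) ∧
  {y : E4 | T₁ < y 0 ∧ ∀ i, ρ (y 0) < ‖E4.spatial y - ξ i (y 0)‖} ⊆ (U₁ : Set E4) ∧
  Tendsto (fun τ ↦ 𝒟.toSpacetime.deviationCk (Minkowski.backgroundOn U₁) Φ₀ 2 τ) atTop (𝓝 0) ∧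
  (∀ i, Tendsto (R i) atTop atTop ∧ ∀ τ, max (Kerr.rPlus (M i) (a i)) 0 + 1 ≤ R i τ) ∧
  (∀ i, Tendsto (fun τ ↦ 𝒟.toSpacetime.truncDeviationCk (B i) (Ψ i) 2 (R i τ) τ) atTop (𝓝 0)) ∧
  O = 𝒟.metric.causalFuture 𝒟.timeOrientation (range 𝒟.embed) ∩
    𝒟.metric.chronologicalPast 𝒟.timeOrientation
      (Φ₀ '' (Minkowski.backgroundOn U₁).lateRegion T₁ ∪ ⋃ i, Ψ i '' (B i).lateRegion T₁) ∧
  (∀ τ₁, T₁ < τ₁ → O \ (Φ₀ '' (Minkowski.backgroundOn U₁).lateRegion τ₁ ∪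
      ⋃ i, Ψ i '' {x : (B i).domain | τ₁ < (B i).time x.1 ∧ (B i).radius x.1 ≤ R i ((B i).time x.1)}) ⊆
    𝒟.toSpacetime.metric.causalPast 𝒟.toSpacetime.timeOrientation
      (Φ₀ '' (Minkowski.backgroundOn U₁).timeSlab τ₁ ∪ ⋃ i, Ψ i '' (B i).truncTimeSlab (R i τ₁) τ₁)) ∧
  (∀ᶠ τ in atTop, ∀ x ∈ (Minkowski.backgroundOn U₁).timeSlab τ,
    𝒟.toSpacetime.timeOrientation.IsFutureDirected (mfderiv 𝓘(ℝ, E4) (𝓡 4) Φ₀ x (E4.basisVector 0)))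

namespace CauchyDevelopment.IsRestFrameSettledOn

variable {𝒟 : CauchyDevelopment D} {N : ℕ} {M a : Fin N → ℝ} {T₁ : ℝ} {ξ : Fin N → ℝ → E3}
  {B : Fin N → ModelBackground} {Ψ : (i : Fin N) → (B i).domain → 𝒟.carrier} {O : Set 𝒟.carrier}
  {U₁ : Opens E4} {Φ₀ : (Minkowski.backgroundOn U₁).domain → 𝒟.carrier} {ρ : ℝ → ℝ}
  {R : Fin N → ℝ → ℝ}

/-- Settled charts on the thinned domain give the seven same-chart settling clauses for the flat chart
`Φ₀` on `Minkowski.backgroundOn U₁` at late time `T₁` (clauses (S1)–(S7) are shared; the bookkeeping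
clauses (C0), (C1), (O1) are dropped). Hypothesis bookkeeping; Dafermos–Luk arXiv:1710.01722, p. 8.
[cite: DafermosLuk2017, p. 8] -/
theorem isRestFrameSettled (h : 𝒟.IsRestFrameSettledOn N M a T₁ ξ B Ψ O U₁ Φ₀ ρ R) :
    𝒟.IsRestFrameSettled N M a T₁ ξ (Minkowski.backgroundOn U₁) B Φ₀ Ψ O ρ R :=
  ⟨h.2.2.1, h.2.2.2.1, h.2.2.2.2.1, h.2.2.2.2.2.1, h.2.2.2.2.2.2.1, h.2.2.2.2.2.2.2.2.1, h.2.2.2.2.2.2.2.2.2⟩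

/-- (C0): the flat chart on the thinned domain is a late-time chart into `O` after `T₁`
(DHRT arXiv:2104.08222, §1, late charts). [cite: arXiv210408222, §1] -/
theorem isLateChart_flat (h : 𝒟.IsRestFrameSettledOn N M a T₁ ξ B Ψ O U₁ Φ₀ ρ R) :
    𝒟.toSpacetime.IsLateChart (Minkowski.backgroundOn U₁) O T₁ Φ₀ :=
  h.1

/-- (C1): every hole chart is a late-time chart into `O` after `T₁` (DHRT arXiv:2104.08222, §1, late
charts). [cite: arXiv210408222, §1] -/
theorem isLateChart (h : 𝒟.IsRestFrameSettledOn N M a T₁ ξ B Ψ O U₁ Φ₀ ρ R) (i : Fin N) :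
    𝒟.toSpacetime.IsLateChart (B i) O T₁ (Ψ i) :=
  h.2.1 i

/-- (S4) + (S5) give near-zone `C²` convergence at every FIXED radius on the thinned-domain form as well
(DHRT arXiv:2104.08222, §1, the region `{r ≤ R}`). [cite: arXiv210408222, §1] -/
theorem tendsto_truncDeviationCk (h : 𝒟.IsRestFrameSettledOn N M a T₁ ξ B Ψ O U₁ Φ₀ ρ R) (i : Fin N)
    (R' : ℝ) :
    Tendsto (fun τ ↦ 𝒟.toSpacetime.truncDeviationCk (B i) (Ψ i) 2 R' τ) atTop (𝓝 0) :=
  h.isRestFrameSettled.tendsto_truncDeviationCk i R'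

end CauchyDevelopment.IsRestFrameSettledOn

end Literature.Geometry.Lorentzian

end
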